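import Mathlib
import Summits.Ventures.PercRepro2.A3LeafGlue
import Summits.Ventures.PercRepro2.A3PendantFreeZ
import Summits.Ventures.PercRepro2.A3PendantMark
import Summits.Ventures.PercRepro2.A3PendantFreeMarks
import Summits.Ventures.PercRepro2.A3PendantFreeRoot

/-!
# The leaf expansion of (MEANS-a₃) on the graph with the leaf deleted, and the pendant paths at a mark
(blind cell PercRepro2, night-1 g32; proofs/NIGHT1-G32.md §4)

`delVertex ends a₃` is the graph with every edge at `a₃` turned into a loop at `a₃` («`G − a₃`»).  With
the leaf surgery (A3PendantFreeZ) and the pinned-leaf glue (A3LeafGlue) the leaf expansion of g31 reads,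
for `a₃` joined to `v` by `f` and otherwise carrying only edges of weight `0`:

  **`A3Between_leaf_del_of`**: (MEANS-a₃)(v) ∧ (FM)(v) on `G − a₃` under `p[f ↦ 1]` ⟹ (MEANS-a₃) at `a₃` on `G`

— the induction step of the pendant class in its natural form (the smaller instance is `G − a₃`).
Consequences: `A3Between_pendant_mark_z` / `FM_pendant_mark_z` (a leaf at a mark, modulo weight-`0`
edges: (MEANS-a₃) by g30, (FM) by `FMfun_leaf_z` and (FM) at the marks), and **`A3Between_path_mark_z`**:
(MEANS-a₃) holds for `a₃ — v — x` with `x ∈ {o, b, a₁, a₂}`, `v` of degree `2` modulo weight-`0` edges —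
the first pendant class at an UNMARKED attachment vertex.  Standard axioms.
-/

namespace Summit.Ventures.PercRepro2

open UnionCluster CovForm

namespace CovForm

namespace A3Fibre

/-! ## Deleting a vertex: every edge at it becomes a loop -/

section DelVertex

variable {V : Type*} {E : Type*} [DecidableEq V] [DecidableEq E]

/-- The graph with every edge at `a₃` turned into a loop at `a₃` (`G − a₃` up to loops). -/
def delVertex (ends : E → Sym2 V) (a₃ : V) : E → Sym2 V :=
  fun e => if a₃ ∈ ends e then s(a₃, a₃) else ends e

omit [DecidableEq E] in
/-- Edges not at `a₃` are unchanged. -/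
lemma delVertex_of_notMem (ends : E → Sym2 V) {a₃ : V} {e : E} (he : a₃ ∉ ends e) :
    delVertex ends a₃ e = ends e := by
  simp [delVertex, he]

omit [DecidableEq E] in
/-- Edges at `a₃` become loops. -/
lemma delVertex_of_mem (ends : E → Sym2 V) {a₃ : V} {e : E} (he : a₃ ∈ ends e) :
    delVertex ends a₃ e = s(a₃, a₃) := by
  simp [delVertex, he]

/-- `leafSurg` leaves the edges not at `a₃` alone. -/
lemma leafSurg_of_notMem (ends : E → Sym2 V) (f : E) {a₃ : V} (v : V) {e : E} (he : a₃ ∉ ends e) :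
    leafSurg ends f a₃ v e = ends e := by
  simp [leafSurg, he]

variable {ends : E → Sym2 V} {f : E} {a₃ v : V}

omit [DecidableEq E] in
/-- On `G − a₃` the edges at `v` other than those at `a₃` are the original ones. -/
lemma mem_delVertex_iff (h3v : a₃ ≠ v) {e : E} : v ∈ delVertex ends a₃ e ↔ (a₃ ∉ ends e ∧ v ∈ ends e) := by
  unfold delVertex
  split_ifs with h
  · simp only [Sym2.mem_iff, or_self, h, not_true_eq_false, false_and, iff_false]
    exact Ne.symm h3v
  · simp [h]

/-- The glued leaf surgery and `G − a₃` differ only on the edges at `a₃` other than `f`. -/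
lemma glueLoop_leafSurg_eq_delVertex_off (hf : ends f = s(a₃, v)) {e : E}
    (he : glueLoop (leafSurg ends f a₃ v) f a₃ e ≠ delVertex ends a₃ e) : a₃ ∈ ends e ∧ e ≠ f := by
  by_contra hc
  apply he
  by_cases hef : e = f
  · subst hef
    rw [glueLoop_self, delVertex_of_mem ends (by rw [hf]; exact Sym2.mem_mk_left _ _)]
  · have h3 : a₃ ∉ ends e := fun h => hc ⟨h, hef⟩
    rw [glueLoop_of_ne _ _ _ hef, leafSurg_of_notMem ends f v h3, delVertex_of_notMem ends h3]

end DelVertex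

/-! ## The leaf expansion on `G − a₃` -/

section LeafDel

variable {V : Type*} {E : Type*} [Fintype V] [DecidableEq V] [Fintype E] [DecidableEq E]
  {R : Type*} [Field R] [LinearOrder R] [IsStrictOrderedRing R]
  {ends : E → Sym2 V} {f : E} {a₃ v : V}

omit [Fintype V] [Fintype E] [LinearOrder R] [IsStrictOrderedRing R] in
/-- Under `p[f ↦ 1]` the glued leaf surgery and `G − a₃` differ only on edges of weight `0`. -/
lemma glueLoop_leafSurg_zero_off {p : E → R} (hf : ends f = s(a₃, v))
    (hz : ∀ e, a₃ ∈ ends e → e ≠ f → p e = 0) :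
    ∀ e, glueLoop (leafSurg ends f a₃ v) f a₃ e ≠ delVertex ends a₃ e → Function.update p f 1 e = 0 := by
  intro e he
  obtain ⟨h3, hef⟩ := glueLoop_leafSurg_eq_delVertex_off hf he
  rw [Function.update_of_ne hef]
  exact hz e h3 hef

/-- **`btw` at `v` under `p[f ↦ 1]` is the same on `G` and on `G − a₃`** (leaf surgery, glue, surgery). -/
theorem btw_del_eq {p : E → R} (hp : IsProbVec p) (hf : ends f = s(a₃, v))
    (hz : ∀ e, a₃ ∈ ends e → e ≠ f → p e = 0) (h3v : a₃ ≠ v) {o a₁ a₂ b : V} (h31 : a₃ ≠ a₁)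
    (h32 : a₃ ≠ a₂) (ho : o ≠ a₃) (hb : b ≠ a₃) :
    btw (Function.update p f 1) ends o a₁ a₂ v b =
      btw (Function.update p f 1) (delVertex ends a₃) o a₁ a₂ v b := by
  have hS : ∀ e, ends e ≠ leafSurg ends f a₃ v e → p e = 0 := leafSurg_zero_off hz v
  have hS₁ : ∀ e, ends e ≠ leafSurg ends f a₃ v e → Function.update p f 1 e = 0 :=
    zero_off_update hS (leafSurg_apply_self ends f a₃ v).symm 1
  have hf₁ : leafSurg ends f a₃ v f = s(a₃, v) := by rw [leafSurg_apply_self, hf]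
  have hleaf₁ : ∀ e, a₃ ∈ leafSurg ends f a₃ v e → e = f := leafSurg_leaf ends f h3v
  have hp₁ : IsProbVec (Function.update p f 1) := hp.update f zero_le_one le_rfl
  have h1 : Function.update p f 1 f = 1 := by simp
  rw [btw_surg hS₁, btw_glue hp₁ h1 hf₁ hleaf₁ h3v h31 h32 ho hb,
    btw_surg (glueLoop_leafSurg_zero_off (p := p) hf hz)]

/-- **`FMfun` at `v` under `p[f ↦ 1]` is the same on `G` and on `G − a₃`.** -/
theorem FMfun_del_eq {p : E → R} (hp : IsProbVec p) (hf : ends f = s(a₃, v))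
    (hz : ∀ e, a₃ ∈ ends e → e ≠ f → p e = 0) (h3v : a₃ ≠ v) {o a₁ a₂ b : V} (h31 : a₃ ≠ a₁)
    (h32 : a₃ ≠ a₂) (ho : o ≠ a₃) (hb : b ≠ a₃) :
    FMfun (Function.update p f 1) ends o a₁ a₂ v b =
      FMfun (Function.update p f 1) (delVertex ends a₃) o a₁ a₂ v b := by
  have hS : ∀ e, ends e ≠ leafSurg ends f a₃ v e → p e = 0 := leafSurg_zero_off hz v
  have hS₁ : ∀ e, ends e ≠ leafSurg ends f a₃ v e → Function.update p f 1 e = 0 :=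
    zero_off_update hS (leafSurg_apply_self ends f a₃ v).symm 1
  have hf₁ : leafSurg ends f a₃ v f = s(a₃, v) := by rw [leafSurg_apply_self, hf]
  have hleaf₁ : ∀ e, a₃ ∈ leafSurg ends f a₃ v e → e = f := leafSurg_leaf ends f h3v
  have hp₁ : IsProbVec (Function.update p f 1) := hp.update f zero_le_one le_rfl
  have h1 : Function.update p f 1 f = 1 := by simp
  rw [FMfun_surg hS₁, FMfun_glue hp₁ h1 hf₁ hleaf₁ h3v h31 h32 ho hb,
    FMfun_surg (glueLoop_leafSurg_zero_off (p := p) hf hz)]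

/-- **The leaf expansion on `G − a₃`**: for `a₃` joined to `v` by `f` and otherwise carrying only edges of
weight `0`, (MEANS-a₃)(v) ∧ (FM)(v) on `G − a₃` under `p[f ↦ 1]` give (MEANS-a₃) at `a₃` on `G`. -/
theorem A3Between_leaf_del_of {p : E → R} (hp : IsProbVec p) (hf : ends f = s(a₃, v))
    (hz : ∀ e, a₃ ∈ ends e → e ≠ f → p e = 0) (h3v : a₃ ≠ v) {o a₁ a₂ b : V} (h31 : a₃ ≠ a₁)
    (h32 : a₃ ≠ a₂) (ho : o ≠ a₃) (hb : b ≠ a₃)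
    (hv : A3Between (Function.update p f 1) (delVertex ends a₃) o a₁ a₂ v b)
    (hFM : 0 ≤ FMfun (Function.update p f 1) (delVertex ends a₃) o a₁ a₂ v b) :
    A3Between p ends o a₁ a₂ a₃ b := by
  refine A3Between_leaf_free_z_of hp hf hz h3v h31 h32 ho hb ?_ ?_
  · unfold A3Between
    rw [btw_del_eq hp hf hz h3v h31 h32 ho hb]
    exact hv
  · rw [FMfun_del_eq hp hf hz h3v h31 h32 ho hb]
    exact hFM

/-- **(HCOV) at `a₃` from (MEANS-a₃)(v) ∧ (FM)(v) on `G − a₃`.** -/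
theorem HCov_leaf_del_of {p : E → R} (hp : IsProbVec p) (hf : ends f = s(a₃, v))
    (hz : ∀ e, a₃ ∈ ends e → e ≠ f → p e = 0) (h3v : a₃ ≠ v) {o a₁ a₂ b : V} (h31 : a₃ ≠ a₁)
    (h32 : a₃ ≠ a₂) (ho : o ≠ a₃) (hb : b ≠ a₃)
    (hv : A3Between (Function.update p f 1) (delVertex ends a₃) o a₁ a₂ v b)
    (hFM : 0 ≤ FMfun (Function.update p f 1) (delVertex ends a₃) o a₁ a₂ v b) :
    HCov p ends o a₁ a₂ a₃ b :=
  HCov_of_a3Between hp ends o a₁ a₂ a₃ b (A3Between_leaf_del_of hp hf hz h3v h31 h32 ho hb hv hFM)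

/-- `FMfun` vanishes when `Q` is null (every fibre is null). -/
lemma FMfun_eq_zero_of_prob_Q_eq_zero' {p : E → R} (hp : IsProbVec p) (ends : E → Sym2 V)
    (o a₁ a₂ v b : V) (hQ : prob p (avoidAll ends a₂ {a₁}) = 0) :
    FMfun p ends o a₁ a₂ v b = 0 := by
  have hz : ∀ W : Finset V, mW p ends a₁ a₂ v W = 0 := fun W =>
    le_antisymm (hQ ▸ prob_mono hp (Set.inter_subset_left : fibre ends a₁ a₂ v W ⊆ _))
      (prob_nonneg hp _)
  have hS : ∀ W : Finset V, Ssig p ends a₁ a₂ v b W = 0 := fun W =>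
    Ssig_eq_zero_of_mW_eq_zero hp ends a₁ a₂ v b W (hz W)
  have hU : ∀ W : Finset V, Su p ends a₁ a₂ v b W = 0 := fun W =>
    Su_eq_zero_of_mW_eq_zero hp ends a₁ a₂ v b W (hz W)
  have hUo : ∀ W : Finset V, Su p ends a₁ a₂ v o W = 0 := fun W =>
    Su_eq_zero_of_mW_eq_zero hp ends a₁ a₂ v o W (hz W)
  unfold FMfun
  simp [hS, hU, hUo, hz, hQ]

/-- **(FM) at `a₃` from (FM)(v) on `G − a₃`**: the leaf closure of (FM) in the deleted form. -/
theorem FM_leaf_del_of {p : E → R} (hp : IsProbVec p) (hf : ends f = s(a₃, v))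
    (hz : ∀ e, a₃ ∈ ends e → e ≠ f → p e = 0) (h3v : a₃ ≠ v) {o a₁ a₂ b : V} (h31 : a₃ ≠ a₁)
    (h32 : a₃ ≠ a₂) (ho : o ≠ a₃) (hb : b ≠ a₃)
    (hFM : 0 ≤ FMfun (Function.update p f 1) (delVertex ends a₃) o a₁ a₂ v b) :
    0 ≤ FMfun p ends o a₁ a₂ a₃ b := by
  rcases eq_or_ne (prob p (avoidAll ends a₂ {a₁})) 0 with hQ | hQ
  · rw [FMfun_eq_zero_of_prob_Q_eq_zero' hp ends o a₁ a₂ a₃ b hQ]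
  · rw [FMfun_leaf_z hp hf hz h3v h31 h32 ho hb hQ, FMfun_del_eq hp hf hz h3v h31 h32 ho hb]
    exact mul_nonneg (hp.nonneg f) hFM

end LeafDel

/-! ## A leaf at a mark, modulo weight-`0` edges: (MEANS-a₃) and (FM) -/

section MarkZ

variable {V : Type*} {E : Type*} [Fintype V] [DecidableEq V] [Fintype E] [DecidableEq E]
  {R : Type*} [Field R] [LinearOrder R] [IsStrictOrderedRing R]
  {ends : E → Sym2 V} {g : E} {v x : V}

/-- **(MEANS-a₃) at a leaf attached to a mark, modulo weight-`0` edges** (g30's `A3Between_pendant_mark`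
through the leaf surgery). -/
theorem A3Between_pendant_mark_z {p : E → R} (hp : IsProbVec p) {o a₁ a₂ b : V}
    (hg : ends g = s(v, x)) (hz : ∀ e, v ∈ ends e → e ≠ g → p e = 0) (hvx : v ≠ x)
    (hx : x = o ∨ x = b ∨ x = a₁ ∨ x = a₂) (hv1 : v ≠ a₁) (hv2 : v ≠ a₂) (ho : o ≠ v) (hb : b ≠ v) :
    A3Between p ends o a₁ a₂ v b := by
  have hS : ∀ e, ends e ≠ leafSurg ends g v x e → p e = 0 := leafSurg_zero_off hz x
  rw [A3Between_surg hS]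
  exact A3Between_pendant_mark hp (by rw [leafSurg_apply_self, hg]) (leafSurg_leaf ends g hvx) hx hv1 hv2
    ho hb

/-- **(FM) at a leaf attached to a mark, modulo weight-`0` edges**: `FMfun_leaf_z` and (FM) at the four
marks (`FM_self_o`, `FM_self_b`, `FM_self_root`, `FM_self_root₂`). -/
theorem FM_pendant_mark_z {p : E → R} (hp : IsProbVec p) {o a₁ a₂ b : V}
    (hg : ends g = s(v, x)) (hz : ∀ e, v ∈ ends e → e ≠ g → p e = 0) (hvx : v ≠ x)
    (hx : x = o ∨ x = b ∨ x = a₁ ∨ x = a₂) (hv1 : v ≠ a₁) (hv2 : v ≠ a₂) (ho : o ≠ v) (hb : b ≠ v) :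
    0 ≤ FMfun p ends o a₁ a₂ v b := by
  rcases eq_or_ne (prob p (avoidAll ends a₂ {a₁})) 0 with hQ | hQ
  · rw [FMfun_eq_zero_of_prob_Q_eq_zero' hp ends o a₁ a₂ v b hQ]
  · rw [FMfun_leaf_z hp hg hz hvx hv1 hv2 ho hb hQ]
    refine mul_nonneg (hp.nonneg g) ?_
    have hp' : IsProbVec (Function.update p g 1) := hp.update g zero_le_one le_rfl
    rcases hx with rfl | rfl | rfl | rfl
    · exact FM_self_o hp' _ _ _ _ _
    · exact FM_self_b hp' _ _ _ _ _
    · exact FM_self_root hp' _ _ _ _ _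
    · exact FM_self_root₂ hp' _ _ _ _ _

end MarkZ

/-! ## The pendant path `a₃ — v — x` at a mark `x` -/

section Path

variable {V : Type*} {E : Type*} [Fintype V] [DecidableEq V] [Fintype E] [DecidableEq E]
  {R : Type*} [Field R] [LinearOrder R] [IsStrictOrderedRing R]
  {ends : E → Sym2 V} {f g : E} {a₃ v x : V}

omit [Fintype V] [Fintype E] [LinearOrder R] [IsStrictOrderedRing R] in
/-- On `G − a₃` under `p[f ↦ 1]`, every edge at `v` other than `g` has weight `0`. -/
lemma delVertex_path_zero {p : E → R} (hf : ends f = s(a₃, v)) (h3v : a₃ ≠ v)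
    (hzv : ∀ e, v ∈ ends e → e ≠ f → e ≠ g → p e = 0) :
    ∀ e, v ∈ delVertex ends a₃ e → e ≠ g → Function.update p f 1 e = 0 := by
  intro e he heg
  rw [mem_delVertex_iff h3v] at he
  have hef : e ≠ f := by
    rintro rfl
    exact he.1 (by rw [hf]; exact Sym2.mem_mk_left _ _)
  rw [Function.update_of_ne hef]
  exact hzv e he.2 hef heg

omit [Fintype V] [Fintype E] [DecidableEq E] [LinearOrder R] [IsStrictOrderedRing R] in
/-- On `G − a₃` the edge `g` still joins `v` to `x`. -/
lemma delVertex_path_edge (hg : ends g = s(v, x)) (h3v : a₃ ≠ v) (h3x : a₃ ≠ x) :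
    delVertex ends a₃ g = s(v, x) := by
  rw [delVertex_of_notMem ends, hg]
  rw [hg, Sym2.mem_iff]
  rintro (h | h)
  · exact h3v h
  · exact h3x h

omit [Fintype V] [DecidableEq V] [Fintype E] [LinearOrder R] [IsStrictOrderedRing R] in
/-- A mark is not `a₃`. -/
lemma ne_of_mark {o a₁ a₂ b : V} (hx : x = o ∨ x = b ∨ x = a₁ ∨ x = a₂) (h31 : a₃ ≠ a₁) (h32 : a₃ ≠ a₂)
    (ho : o ≠ a₃) (hb : b ≠ a₃) : a₃ ≠ x := by
  rcases hx with rfl | rfl | rfl | rfl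
  · exact Ne.symm ho
  · exact Ne.symm hb
  · exact h31
  · exact h32

/-- **(MEANS-a₃) on the pendant path `a₃ — v — x` at a mark `x`** (`v` unmarked, of degree `2` modulo
weight-`0` edges; `a₃` a leaf modulo weight-`0` edges): the leaf expansion on `G − a₃` with (MEANS-a₃)(v)
by g30's mark classes and (FM)(v) by the leaf closure of (FM) down to the mark. -/
theorem A3Between_path_mark_z {p : E → R} (hp : IsProbVec p) (hf : ends f = s(a₃, v))
    (hg : ends g = s(v, x)) (hz3 : ∀ e, a₃ ∈ ends e → e ≠ f → p e = 0)
    (hzv : ∀ e, v ∈ ends e → e ≠ f → e ≠ g → p e = 0) {o a₁ a₂ b : V}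
    (hx : x = o ∨ x = b ∨ x = a₁ ∨ x = a₂) (h3v : a₃ ≠ v) (hvx : v ≠ x) (h31 : a₃ ≠ a₁) (h32 : a₃ ≠ a₂)
    (ho : o ≠ a₃) (hb : b ≠ a₃) (hv1 : v ≠ a₁) (hv2 : v ≠ a₂) (hov : o ≠ v) (hbv : b ≠ v) :
    A3Between p ends o a₁ a₂ a₃ b := by
  have h3x : a₃ ≠ x := ne_of_mark hx h31 h32 ho hb
  have hp₁ : IsProbVec (Function.update p f 1) := hp.update f zero_le_one le_rfl
  have hg' := delVertex_path_edge (a₃ := a₃) hg h3v h3x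
  have hz' := delVertex_path_zero (g := g) hf h3v hzv
  exact A3Between_leaf_del_of hp hf hz3 h3v h31 h32 ho hb
    (A3Between_pendant_mark_z hp₁ hg' hz' hvx hx hv1 hv2 hov hbv)
    (FM_pendant_mark_z hp₁ hg' hz' hvx hx hv1 hv2 hov hbv)

/-- **(HCOV) on the pendant path `a₃ — v — x` at a mark `x`.** -/
theorem HCov_path_mark_z {p : E → R} (hp : IsProbVec p) (hf : ends f = s(a₃, v))
    (hg : ends g = s(v, x)) (hz3 : ∀ e, a₃ ∈ ends e → e ≠ f → p e = 0)
    (hzv : ∀ e, v ∈ ends e → e ≠ f → e ≠ g → p e = 0) {o a₁ a₂ b : V}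
    (hx : x = o ∨ x = b ∨ x = a₁ ∨ x = a₂) (h3v : a₃ ≠ v) (hvx : v ≠ x) (h31 : a₃ ≠ a₁) (h32 : a₃ ≠ a₂)
    (ho : o ≠ a₃) (hb : b ≠ a₃) (hv1 : v ≠ a₁) (hv2 : v ≠ a₂) (hov : o ≠ v) (hbv : b ≠ v) :
    HCov p ends o a₁ a₂ a₃ b :=
  HCov_of_a3Between hp ends o a₁ a₂ a₃ b
    (A3Between_path_mark_z hp hf hg hz3 hzv hx h3v hvx h31 h32 ho hb hv1 hv2 hov hbv)

end Path

/-! ## Pendant paths of any length at a mark -/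

section PathAny

variable {V : Type*} {E : Type*} [Fintype V] [DecidableEq V] [Fintype E] [DecidableEq E]
  {R : Type*} [Field R] [LinearOrder R] [IsStrictOrderedRing R]

/-- `PendantPathAt o a₁ a₂ b x ends p v n`: `v` is the far end of a pendant path of `n ≥ 1` edges ending at
the vertex `x`, every path vertex unmarked and of degree `2` (`1` at the far end) modulo edges of
weight `0`; the recursion deletes the current far end (`delVertex`) and pins its edge open. -/
inductive PendantPathAt (o a₁ a₂ b x : V) : (E → Sym2 V) → (E → R) → V → ℕ → Prop
  | leaf {ends : E → Sym2 V} {p : E → R} {v : V} (g : E) (hg : ends g = s(v, x))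
      (hz : ∀ e, v ∈ ends e → e ≠ g → p e = 0) (hvx : v ≠ x) (hv1 : v ≠ a₁) (hv2 : v ≠ a₂)
      (ho : o ≠ v) (hb : b ≠ v) : PendantPathAt o a₁ a₂ b x ends p v 1
  | step {ends : E → Sym2 V} {p : E → R} {v u : V} {n : ℕ} (g : E) (hg : ends g = s(v, u))
      (hz : ∀ e, v ∈ ends e → e ≠ g → p e = 0) (hvu : v ≠ u) (hv1 : v ≠ a₁) (hv2 : v ≠ a₂)
      (ho : o ≠ v) (hb : b ≠ v)
      (h : PendantPathAt o a₁ a₂ b x (delVertex ends v) (Function.update p g 1) u n) :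
      PendantPathAt o a₁ a₂ b x ends p v (n + 1)

/-- **(MEANS-a₃) and (FM) at the far end of a pendant path of any length at a mark**: induction along
the path with `A3Between_leaf_del_of` / `FM_leaf_del_of` (the step) and the mark classes (the base). -/
theorem A3Between_and_FM_of_pendantPathAt {o a₁ a₂ b x : V} (hx : x = o ∨ x = b ∨ x = a₁ ∨ x = a₂)
    {ends : E → Sym2 V} {p : E → R} {v : V} {n : ℕ} (h : PendantPathAt o a₁ a₂ b x ends p v n)
    (hp : IsProbVec p) :
    A3Between p ends o a₁ a₂ v b ∧ 0 ≤ FMfun p ends o a₁ a₂ v b := by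
  induction h with
  | leaf g hg hz hvx hv1 hv2 ho hb =>
    exact ⟨A3Between_pendant_mark_z hp hg hz hvx hx hv1 hv2 ho hb,
      FM_pendant_mark_z hp hg hz hvx hx hv1 hv2 ho hb⟩
  | step g hg hz hvu hv1 hv2 ho hb _ ih =>
    obtain ⟨h1, h2⟩ := ih (hp.update g zero_le_one le_rfl)
    exact ⟨A3Between_leaf_del_of hp hg hz hvu hv1 hv2 ho hb h1 h2,
      FM_leaf_del_of hp hg hz hvu hv1 hv2 ho hb h2⟩

/-- **(MEANS-a₃) at the far end of a pendant path at a mark.** -/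
theorem A3Between_of_pendantPathAt {o a₁ a₂ b x : V} (hx : x = o ∨ x = b ∨ x = a₁ ∨ x = a₂)
    {ends : E → Sym2 V} {p : E → R} {v : V} {n : ℕ} (h : PendantPathAt o a₁ a₂ b x ends p v n)
    (hp : IsProbVec p) : A3Between p ends o a₁ a₂ v b :=
  (A3Between_and_FM_of_pendantPathAt hx h hp).1

/-- **(HCOV) at the far end of a pendant path at a mark.** -/
theorem HCov_of_pendantPathAt {o a₁ a₂ b x : V} (hx : x = o ∨ x = b ∨ x = a₁ ∨ x = a₂)
    {ends : E → Sym2 V} {p : E → R} {v : V} {n : ℕ} (h : PendantPathAt o a₁ a₂ b x ends p v n)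
    (hp : IsProbVec p) : HCov p ends o a₁ a₂ v b :=
  HCov_of_a3Between hp ends o a₁ a₂ v b (A3Between_of_pendantPathAt hx h hp)

end PathAny

end A3Fibre

end CovForm

end Summit.Ventures.PercRepro2
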